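import Summits.ABC.ABC.Theses.IsogenyGlueCongruence
import Literature.NumberTheory.EllipticCurves.TakahashiDegreeFormulaSetupProofs
import Literature.NumberTheory.DiophantineGeometry.PastenValuationProductsProofs
import Literature.NumberTheory.Automorphic.BrandtXi

set_option linter.dupNamespace false

/-!
# Crux `SharpDegreeOfPolyDegree` (stmt-ABC-10895), line `Sketch`: Takahashi's bound (TB)

`R := SharpDegreeOfPolyDegree = (Poly → X)`.  This support file (lands `--supports stmt-ABC-10895`)
proves the registered stub `stub_takahashiBound` of the line's skeleton
(`Cruxes/SharpDegreeOfPolyDegree/Lines/Sketch.lean`), verbatim: granted the named fact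
`takahashi2001_thm_2_3` (Takahashi 2001, Thm. 2.3: `δ · i = ξ · j`, `i · j = ord_q Δ_min`, `i ≥ 1`
at the optimal curve; a hypothesis here, not discharged), a datum `D₀` at squarefree level
`L = N_{W₀}` of minimal degree among all data (of all curves) with the same newform satisfies
`deg D₀ ≤ ξ(L/q, q)(a(W₀)) · ord_q Δ_min(W₀)` for every prime `q ∣ L`.

This is the tree theorem `takahashi2001_thm_2_3.modularDegree_le_brandtXi_mul'`
(`Literature/NumberTheory/EllipticCurves/TakahashiDegreeFormulaSetupProofs.lean`) at
`(M, r) := (L/q, q)`; the only work is the transport of the level along `L/q · q = L`, done by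
substituting `L = M · q` (`M := L/q`, `Nat.div_mul_cancel`) and `M · q / q = M` (`Nat.mul_div_cancel`).

Theorems only (no definition, no named fact); `R` itself is not touched here.
-/

noncomputable section

namespace Summit.ABC.ABC.Theorems.SharpDegreeOfPolyDegree

open Literature.NumberTheory.EllipticCurves Literature.NumberTheory.EllipticCurves.ModularForms
open Literature.NumberTheory.DiophantineGeometry Literature.NumberTheory.Automorphic
open WeierstrassCurve

/-! ## The stub -/

/-- **(TB) Takahashi's bound for an optimal datum from the named fact** — the registered stub
`stub_takahashiBound` of the line's skeleton (`Cruxes/SharpDegreeOfPolyDegree/Lines/Sketch.lean`),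
verbatim.  For `W₀/ℚ` of squarefree conductor `L`, a prime `q ∣ L` and a datum `D₀` at level `L` of
minimal degree among all data with the same newform, `deg D₀ ≤ ξ(L/q, q)(a(W₀)) · v_q(Δ_min W₀)`:
`takahashi2001_thm_2_3.modularDegree_le_brandtXi_mul'` at `(M, r) := (L/q, q)`, transported along
`L/q · q = L` (`Nat.div_mul_cancel`, `Nat.mul_div_cancel`). [cite: Takahashi2001, Thm. 2.3] -/
theorem stub_takahashiBound :
    takahashi2001_thm_2_3 →
    ∀ (W₀ : WeierstrassCurve ℚ) [W₀.IsElliptic] (L : ℕ) [NeZero L], W₀.conductorNorm ℤ = L →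
      Squarefree L → ∀ q : ℕ, q.Prime → q ∣ L →
        ∀ D₀ : ModularParametrizationData W₀ L,
          (∀ (W' : WeierstrassCurve ℚ) [W'.IsElliptic] (D' : ModularParametrizationData W' L),
              D'.f = D₀.f → D₀.modularDegree ≤ D'.modularDegree) →
            D₀.modularDegree ≤
              brandtXi (L / q) q (fun n => W₀.LFunction n) *
                (W₀.minimalDiscriminantNorm ℤ).factorization q := by
  intro hT W₀ _ L _ hN hsq q hq hqL
  -- write the level as a product `L = M · q`, `M := L / q`
  obtain ⟨M, rfl⟩ : ∃ M, L = M * q := ⟨L / q, (Nat.div_mul_cancel hqL).symm⟩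
  intro D₀ hmin
  rw [Nat.mul_div_cancel M hq.pos]
  exact hT.modularDegree_le_brandtXi_mul' W₀ M q hq hsq hN D₀ hmin

end Summit.ABC.ABC.Theorems.SharpDegreeOfPolyDegree

end
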